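import Literature.Analysis.FunctionSpaces.TorusTimeAverage
import Mathlib.Analysis.Calculus.ContDiff.Convolution
import HarnessLib

/-!
# Space–time lifts of mollified fields on `T^d`: local integrability and smoothness

Analysis/FunctionSpaces support file (serves the discharge of Onsager rigidity,
`Literature.Analysis.FluidPDE.onsager_rigidity`, `FluidPDE/Onsager`: the test field built from a weak solution by
mollification in space and time must be a genuine space–time test field, i.e. its lift to
`ℝ × ℝ^d` must be `C^∞`; Constantin–E–Titi 1994, p. 208).

* `Torus.locallyIntegrable_stLift` — the space–time lift `stLift G : ℝ × ℝ^d → F` of a field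
  `G` with `uncurry G ∈ L¹(ℝ × T^d)` is locally integrable (every point has the neighbourhood
  `ℝ × (y₀ + (-½, ½)^d)`, a translate of a fundamental domain, on which `id × proj` is measure
  preserving onto `ℝ × T^d`);
* `Torus.stLift_convolution_timeAvgWith` — **the lift identity**: the lift of the space–time
  mollification `t ↦ (timeAvgWith r G t) ⋆ kernel ε` is Mathlib's convolution on `ℝ × ℝ^d` of
  the product kernel `(s, v) ↦ r(s) ρ_ε(v)` with `stLift G`;
* `Torus.contDiff_stLift_convolution_timeAvgWith` — hence it is `C^∞` jointly in space–time
  for `r` smooth and compactly supported (Mathlib's `HasCompactSupport.contDiff_convolution_left`),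
  and the vector (componentwise) version `Torus.contDiff_stLift_vecMollify_timeAvgWith`.

## Mathlib search

Mathlib (this pin) has smoothness of convolutions by smooth compactly supported kernels on
finite-dimensional real vector spaces (`HasCompactSupport.contDiff_convolution_left`) and the
existence of such convolutions against locally integrable functions
(`HasCompactSupport.convolutionExists_left`); there is no periodic / torus variant (searched
`AddCircle` + `convolution`, `UnitAddTorus` in `Mathlib/Analysis`).

## References

* P. Constantin, W. E, E. S. Titi, *Onsager's conjecture on the energy conservation for solutions
  of Euler's equation*, Comm. Math. Phys. 165 (1994), 207–209, p. 208.
* L. Grafakos, *Classical Fourier Analysis*, 3rd ed. (2014), §3.1.1 (fundamental domains of `Tⁿ`).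
-/

noncomputable section

open MeasureTheory TopologicalSpace Set Function Filter Topology Metric ContinuousLinearMap
open scoped ENNReal NNReal Convolution InnerProductSpace ContDiff

namespace Literature.Analysis.FunctionSpaces

namespace Torus

variable {d : Type*} [Fintype d]
variable {F : Type*} [NormedAddCommGroup F] [NormedSpace ℝ F]

/-! ## Local integrability of space–time lifts -/

section LocInt

/-- `proj` is measure preserving from any translate `{v | v - w ∈ [0,1)^d}` of the fundamental
domain onto the torus. [cite: Grafakos2014, §3.1.1] -/
theorem measurePreserving_proj_translate (w : EuclideanSpace ℝ d) :
    MeasurePreserving (proj : EuclideanSpace ℝ d → UnitAddTorus d)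
      (volume.restrict ((fun v => v - w) ⁻¹' unitCube d)) volume := by
  classical
  have h1 : MeasurePreserving (fun v : EuclideanSpace ℝ d => v - w)
      (volume.restrict ((fun v => v - w) ⁻¹' unitCube d)) (volume.restrict (unitCube d)) :=
    (measurePreserving_sub_right volume w).restrict_preimage measurableSet_unitCube
  have h2 := (measurePreserving_add_right (volume : Measure (UnitAddTorus d)) (proj w)).comp
    ((measurePreserving_proj_unitCube_holds (d := d)).comp h1)
  have heq : ((fun x : UnitAddTorus d => x + proj w) ∘ proj ∘ fun v : EuclideanSpace ℝ d => v - w) =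
      proj := by
    funext v
    simp only [comp_apply, proj_sub, sub_add_cancel]
  rw [heq] at h2
  exact h2

/-- `id × proj` is measure preserving from `ℝ × {v | v - w ∈ [0,1)^d}` onto `ℝ × T^d`. [folklore] -/
theorem measurePreserving_prodMap_proj_translate (w : EuclideanSpace ℝ d) :
    MeasurePreserving (Prod.map id proj : ℝ × EuclideanSpace ℝ d → ℝ × UnitAddTorus d)
      ((volume : Measure ℝ).prod (volume.restrict ((fun v => v - w) ⁻¹' unitCube d)))
      ((volume : Measure ℝ).prod volume) :=
  (MeasurePreserving.id volume).prod (measurePreserving_proj_translate w)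

/-- The translate `{v | v - (y₀ - c) ∈ [0,1)^d}`, `c = (½, …, ½)`, is a neighbourhood of `y₀`
(it contains the ball `B(y₀, ½)`). [folklore] -/
theorem translate_unitCube_mem_nhds (y₀ : EuclideanSpace ℝ d) :
    (fun v => v - (y₀ - cubeCenter d)) ⁻¹' unitCube d ∈ 𝓝 y₀ := by
  refine mem_of_superset (ball_mem_nhds y₀ one_half_pos) fun v hv => ?_
  rw [mem_ball, dist_eq_norm] at hv
  simp only [mem_preimage, mem_unitCube]
  intro i
  have hi : |(v - y₀) i| ≤ ‖v - y₀‖ := by simpa using PiLp.norm_apply_le (v - y₀) i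
  have hi' := abs_lt.1 (lt_of_le_of_lt hi hv)
  simp only [PiLp.sub_apply, cubeCenter_apply, mem_Ico] at hi' ⊢
  constructor <;> linarith [hi'.1, hi'.2]

omit [NormedSpace ℝ F] in
/-- **Space–time lifts of integrable fields are locally integrable**: if
`uncurry G ∈ L¹(ℝ × T^d)` then `stLift G ∈ L¹_loc(ℝ × ℝ^d)`. [folklore] -/
theorem locallyIntegrable_stLift {G : ℝ → UnitAddTorus d → F}
    (hG : Integrable (uncurry G) ((volume : Measure ℝ).prod volume)) :
    LocallyIntegrable (stLift G) (volume : Measure (ℝ × EuclideanSpace ℝ d)) := by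
  intro p
  set S : Set (EuclideanSpace ℝ d) := (fun v => v - (p.2 - cubeCenter d)) ⁻¹' unitCube d with hS
  refine ⟨univ ×ˢ S, prod_mem_nhds univ_mem (translate_unitCube_mem_nhds p.2), ?_⟩
  have hmp := measurePreserving_prodMap_proj_translate (d := d) (p.2 - cubeCenter d)
  have hint : Integrable (uncurry G ∘ Prod.map id proj)
      ((volume : Measure ℝ).prod (volume.restrict S)) :=
    (hmp.integrable_comp hG.aestronglyMeasurable).2 hG
  have hfun : (stLift G : ℝ × EuclideanSpace ℝ d → F) = uncurry G ∘ Prod.map id proj := by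
    funext q
    rfl
  rw [IntegrableOn, hfun, Measure.volume_eq_prod, ← Measure.prod_restrict, Measure.restrict_univ]
  exact hint

end LocInt


/-! ## The lift identity and joint smoothness -/

section Lift

variable {ε : ℝ}

/-- Haar structure of Lebesgue measure on `ℝ × ℝ^d` (product of Haar measures). [folklore] -/
theorem isAddHaarMeasure_volume_prod :
    (volume : Measure (ℝ × EuclideanSpace ℝ d)).IsAddHaarMeasure := by
  change ((volume : Measure ℝ).prod (volume : Measure (EuclideanSpace ℝ d))).IsAddHaarMeasure
  infer_instance

/-- **Spatial mollification on the torus read on `ℝ^d`**: for `θ ∈ L¹(T^d)`,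
`(θ ⋆ kernel ε)(proj v) = ∫_{ℝ^d} ρ_ε(y') θ(proj (v - y')) dy'` (`0 < ε ≤ 1/4`; the profile is
supported in the centred fundamental domain, `Torus.integral_comp_reprc_of_support_subset`).
[folklore] -/
theorem convolution_kernel_apply_proj {θ : UnitAddTorus d → ℝ} (hε : 0 < ε) (hε' : ε ≤ 1 / 4)
    (v : EuclideanSpace ℝ d) :
    (θ ⋆ kernel ε) (proj v) = ∫ y' : EuclideanSpace ℝ d, profile ε y' * θ (proj (v - y')) := by
  rw [convolution_comm_real, convolution_lsmul]
  have hsupp : support (fun y' : EuclideanSpace ℝ d => profile ε y' * θ (proj (v - y'))) ⊆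
      ball 0 (1 / 2) := by
    intro y' hy'
    rw [mem_support, mul_ne_zero_iff] at hy'
    exact ball_subset_ball (by linarith) (support_profile_subset hε hy'.1)
  rw [← integral_comp_reprc_of_support_subset hsupp]
  refine integral_congr_ae (Eventually.of_forall fun z => ?_)
  simp only [smul_eq_mul, proj_sub, proj_reprc, kernel, transplant_apply]

/-- **The lift identity.** For `uncurry G ∈ L¹(ℝ × T^d)` (real valued), a continuous compactly
supported time kernel `r` and `0 < ε ≤ 1/4`, the space–time lift of the mollified field
`t ↦ (timeAvgWith r G t) ⋆ kernel ε` is Mathlib's convolution on `ℝ × ℝ^d` of the product kernel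
`stKernel r ε` with `stLift G`. [folklore] -/
theorem stLift_convolution_timeAvgWith {G : ℝ → UnitAddTorus d → ℝ}
    (hG : Integrable (uncurry G) ((volume : Measure ℝ).prod volume)) {r : ℝ → ℝ}
    (hr : Continuous r) (hrc : HasCompactSupport r) (hε : 0 < ε) (hε' : ε ≤ 1 / 4) :
    stLift (fun t => (timeAvgWith r G t) ⋆ kernel ε) =
      stKernel r ε ⋆[lsmul ℝ ℝ, volume] stLift G := by
  haveI := isAddHaarMeasure_volume_prod (d := d)
  have hGl := locallyIntegrable_stLift hG
  have hex : ConvolutionExists (stKernel (d := d) r ε) (stLift G) (lsmul ℝ ℝ) volume :=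
    (hasCompactSupport_stKernel hrc hε).convolutionExists_left (lsmul ℝ ℝ)
      (continuous_stKernel hr ε) hGl
  funext p
  obtain ⟨t, v⟩ := p
  -- left-hand side
  rw [stLift_apply, timeAvgWith_convolution hG hr hrc (continuous_kernel hε hε') t, timeAvgWith_apply]
  -- right-hand side as an iterated integral
  rw [convolution_def, Measure.volume_eq_prod, integral_prod _ (by
    have h := hex (t, v)
    rw [ConvolutionExistsAt, Measure.volume_eq_prod] at h
    exact h)]
  refine integral_congr_ae (Eventually.of_forall fun s => ?_)
  simp only [lsmul_apply, smul_eq_mul, stKernel_apply, Prod.mk_sub_mk, stLift_apply, mul_assoc]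
  rw [integral_const_mul, convolution_kernel_apply_proj hε hε' v]

/-- **Joint smoothness of space–time mollifications.** For `uncurry G ∈ L¹(ℝ × T^d)` (real
valued), a smooth compactly supported time kernel `r` and `0 < ε ≤ 1/4`, the space–time lift of
`t ↦ (timeAvgWith r G t) ⋆ kernel ε` is `C^∞` on `ℝ × ℝ^d`. [folklore] -/
theorem contDiff_stLift_convolution_timeAvgWith {G : ℝ → UnitAddTorus d → ℝ}
    (hG : Integrable (uncurry G) ((volume : Measure ℝ).prod volume)) {r : ℝ → ℝ}
    (hr : ContDiff ℝ ∞ r) (hrc : HasCompactSupport r) (hε : 0 < ε) (hε' : ε ≤ 1 / 4) :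
    ContDiff ℝ ∞ (stLift (fun t => (timeAvgWith r G t) ⋆ kernel ε)) := by
  haveI := isAddHaarMeasure_volume_prod (d := d)
  rw [stLift_convolution_timeAvgWith hG hr.continuous hrc hε hε']
  exact (hasCompactSupport_stKernel hrc hε).contDiff_convolution_left (lsmul ℝ ℝ)
    (contDiff_stKernel hr ε) (locallyIntegrable_stLift hG)

end Lift

end Torus

end Literature.Analysis.FunctionSpaces
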